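import Literature.Computability.Complexity.StackArith
import HarnessLib

/-!
# Binary to unary in linear time (PPST 1983, §3 — the verifier's index conversions)

Literature / complexity toolkit, a machine brick of the inline formalization of
Paul–Pippenger–Szemerédi–Trotter 1983 (`PaulPippengerSzemerediTrotter1983.lean`, fact
`PaulEtAl1983_NTIME_not_subset_DTIME`; roadmap Layer 4, the linear-time verifier). The verifier
receives indices in binary (record and entry numbers in the check descriptor, entry indices,
claimed touchers and pointers) and consumes them as unary countdowns when locating segments.
This file converts a binary numeral (least significant bit first) into `1ᵛ` by doubling, most
significant bit first, in time LINEAR IN THE VALUE (the doublings form a geometric series; the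
routine `Com.binToUnary` of `StackWords.lean` does the same work but is only proved within
`O(value · bits)`, which is not enough for the linear-time verifier):

* `Com.dbl acc t u v` (double an all-`1` register: copy it, pour the copy back),
  `Com.binToUnaryLin src acc p q r`;
* `msbValFrom` (the value of a most-significant-first bit list from a start value),
  `msbVal_reverse` (`= bitsToNat` on the reversed numeral), `b2uCost` / `b2uCost_le` (the
  doublings form a geometric series);
* **`runs_binToUnaryLin`** — `acc := 1^(bitsToNat src)`, `src` emptied, within
  `26 · bitsToNat src + 10 · |src| + 2` steps.

No named fact is introduced (definitions with bodies and theorems only).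

## References

* W. J. Paul, N. Pippenger, E. Szemerédi, W. T. Trotter, *On determinism versus non-determinism
  and related problems*, FOCS 1983, 429–438, §3 [PaulEtAl1983].
-/

namespace Literature.Computability.Complexity

open Function

namespace Com

variable {ι : Type} [DecidableEq ι]

/-! ### Doubling -/

/-- **Double** the all-`1` register `acc`: copy it onto `t` (temporaries `u`, `v`), pour `t`
back. [folklore] -/
def dbl (acc t u v : ι) : Com ι := copy acc t u v ;; pour t acc

/-- The value of a most-significant-first bit list read from the start value `a`. [folklore] -/
def msbValFrom (a : ℕ) : List Bool → ℕ
  | [] => a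
  | b :: ms => msbValFrom (2 * a + b.toNat) ms

/-- Appending a least significant bit. [folklore] -/
theorem msbVal_append (a : ℕ) (ms : List Bool) (b : Bool) :
    msbValFrom a (ms ++ [b]) = 2 * msbValFrom a ms + b.toNat := by
  induction ms generalizing a with
  | nil => simp [msbValFrom]
  | cons m ms ih => simp [msbValFrom, ih]

/-- **Most significant first is least significant first, reversed.** [folklore] -/
theorem msbVal_reverse (w : List Bool) : msbValFrom 0 w.reverse = bitsToNat w := by
  induction w with
  | nil => rfl
  | cons b w ih =>
    rw [List.reverse_cons, msbVal_append, ih, bitsToNat_cons]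
    cases b <;> simp; ring

/-- Simulation of `dbl` on an all-`1` register. [folklore] -/
theorem runs_dbl {acc t u v : ι} (hat : acc ≠ t) (hau : acc ≠ u) (hav : acc ≠ v) (htu : t ≠ u)
    (htv : t ≠ v) (huv : u ≠ v) (n : ℕ) (R : Regs ι) (hacc : R acc = List.replicate n true)
    (ht : R t = []) (hu : R u = []) (hv : R v = []) :
    Runs (dbl acc t u v) R (update R acc (List.replicate (2 * n) true)) (13 * n + 4) := by
  have h1 := runs_copy (a := acc) (b := t) (t := u) (u := v) hat hau hav htu htv huv R hu hv
  rw [hacc, ht, List.append_nil, List.length_replicate] at h1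
  have h2 := runs_pour (a := t) (b := acc) hat.symm (update R t (List.replicate n true))
  simp only [update_self, List.reverse_replicate, List.length_replicate, update_idem] at h2
  rw [update_of_ne hat, hacc] at h2
  refine (h1.seq h2).of_eq ?_ (by omega)
  funext i
  rcases eq_or_ne i acc with rfl | hia
  · simp [Nat.two_mul]
  · rw [update_of_ne hia, update_of_ne hia]
    rcases eq_or_ne i t with rfl | hit
    · rw [update_self, ht]
    · rw [update_of_ne hit]

/-! ### The conversion -/

/-- **Binary to unary**: reverse the numeral onto `p` (most significant bit on top), then for
each bit double `acc` and add the bit (temporaries `q`, `r` and the emptied `src`). [folklore] -/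
def binToUnaryLin (src acc p q r : ι) : Com ι :=
  pour src p ;; loop p (dbl acc q r src ;; push acc true) (dbl acc q r src)

/-- The cost of the doubling loop from value `a` over the bits `ms`. [folklore] -/
def b2uCost (a : ℕ) : List Bool → ℕ
  | [] => 1
  | b :: ms => 13 * a + 6 + b.toNat + b2uCost (2 * a + b.toNat) ms

/-- **The doublings form a geometric series**: the loop costs at most `26 · value + 7 · |bits| + 1`.
[folklore] -/
theorem b2uCost_le (a : ℕ) : ∀ ms : List Bool, b2uCost a ms + 13 * a ≤ 26 * msbValFrom a ms + 7 * ms.length + 1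
  | [] => by simp [b2uCost, msbValFrom]; omega
  | b :: ms => by
    have ih := b2uCost_le (2 * a + b.toNat) ms
    simp only [b2uCost, msbValFrom, List.length_cons]
    cases b <;> simp at ih ⊢ <;> omega

/-- Simulation of the doubling loop. [folklore] -/
theorem runs_b2uLoop {src acc p q r : ι} (has : acc ≠ src) (hap : acc ≠ p) (haq : acc ≠ q)
    (har : acc ≠ r) (hsp : src ≠ p) (hsq : src ≠ q) (hsr : src ≠ r) (hpq : p ≠ q) (hpr : p ≠ r)
    (hqr : q ≠ r) : ∀ (ms : List Bool) (a : ℕ) (R : Regs ι), R p = ms → R acc = List.replicate a true →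
      R q = [] → R r = [] → R src = [] →
      Runs (loop p (dbl acc q r src ;; push acc true) (dbl acc q r src)) R
        (update (update R p []) acc (List.replicate (msbValFrom a ms) true)) (b2uCost a ms)
  | [], a, R, hp, hacc, _, _, _ => by
    refine (Runs.loop_nil _ _ hp).of_eq ?_ (by simp [b2uCost])
    simp only [msbValFrom]
    funext i
    rcases eq_or_ne i acc with rfl | h1
    · rw [update_self, hacc]
    · rw [update_of_ne h1]
      rcases eq_or_ne i p with rfl | h2
      · rw [update_self, hp]
      · rw [update_of_ne h2]
  | b :: ms, a, R, hp, hacc, hq, hr, hs => by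
    set R₀ := update R p ms with hR₀
    have hd := runs_dbl (acc := acc) (t := q) (u := r) (v := src) haq har has hqr hsq.symm hsr.symm a R₀
      (by rw [hR₀, update_of_ne hap, hacc]) (by rw [hR₀, update_of_ne hpq.symm, hq])
      (by rw [hR₀, update_of_ne hpr.symm, hr]) (by rw [hR₀, update_of_ne hsp, hs])
    -- the state after the body, for either bit
    have hnext : ∀ c : Bool, (update R₀ acc (List.replicate (2 * a + c.toNat) true)) p = ms ∧
        (update R₀ acc (List.replicate (2 * a + c.toNat) true)) acc = List.replicate (2 * a + c.toNat) true ∧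
        (update R₀ acc (List.replicate (2 * a + c.toNat) true)) q = [] ∧
        (update R₀ acc (List.replicate (2 * a + c.toNat) true)) r = [] ∧
        (update R₀ acc (List.replicate (2 * a + c.toNat) true)) src = [] := by
      intro c
      refine ⟨?_, by simp, ?_, ?_, ?_⟩
      · rw [update_of_ne hap.symm, hR₀, update_self]
      · rw [update_of_ne haq.symm, hR₀, update_of_ne hpq.symm, hq]
      · rw [update_of_ne har.symm, hR₀, update_of_ne hpr.symm, hr]
      · rw [update_of_ne has.symm, hR₀, update_of_ne hsp, hs]
    have hfin : ∀ c : Bool, update (update (update R₀ acc (List.replicate (2 * a + c.toNat) true)) p [])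
        acc (List.replicate (msbValFrom (2 * a + c.toNat) ms) true) =
        update (update R p []) acc (List.replicate (msbValFrom a (c :: ms)) true) := by
      intro c
      simp only [msbValFrom, hR₀]
      funext i
      rcases eq_or_ne i acc with rfl | h2
      · rw [update_self, update_self]
      · rw [update_of_ne h2, update_of_ne h2]
        rcases eq_or_ne i p with rfl | h1
        · rw [update_self, update_self]
        · rw [update_of_ne h1, update_of_ne h1, update_of_ne h2, update_of_ne h1]
    cases b
    · -- bit `0`: double
      obtain ⟨n1, n2, n3, n4, n5⟩ := hnext false
      have ih := runs_b2uLoop has hap haq har hsp hsq hsr hpq hpr hqr ms (2 * a + Bool.toNat false) _ n1 n2 n3 n4 n5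
      refine (Runs.loop_false hp (by simpa using hd) ih).of_eq (hfin false) ?_
      simp [b2uCost]
    · -- bit `1`: double and add one
      have hbody : Runs (dbl acc q r src ;; push acc true) R₀
          (update R₀ acc (List.replicate (2 * a + Bool.toNat true) true)) (13 * a + 5) := by
        have hpush := Runs.push acc true (update R₀ acc (List.replicate (2 * a) true))
        refine (hd.seq hpush).of_eq ?_ (by omega)
        simp [List.replicate_succ]
      obtain ⟨n1, n2, n3, n4, n5⟩ := hnext true
      have ih := runs_b2uLoop has hap haq har hsp hsq hsr hpq hpr hqr ms (2 * a + Bool.toNat true) _ n1 n2 n3 n4 n5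
      refine (Runs.loop_true hp hbody ih).of_eq (hfin true) ?_
      simp [b2uCost]

/-- **Simulation of `binToUnaryLin`**: `acc := 1^(bitsToNat src)`, `src` emptied, all temporaries
clean, within `26 · bitsToNat src + 10 · |src| + 2` steps. [folklore] -/
theorem runs_binToUnaryLin {src acc p q r : ι} (has : acc ≠ src) (hap : acc ≠ p) (haq : acc ≠ q)
    (har : acc ≠ r) (hsp : src ≠ p) (hsq : src ≠ q) (hsr : src ≠ r) (hpq : p ≠ q) (hpr : p ≠ r)
    (hqr : q ≠ r) (R : Regs ι) (hacc : R acc = []) (hp : R p = []) (hq : R q = []) (hr : R r = []) :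
    Runs (binToUnaryLin src acc p q r) R
      (update (update R src []) acc (List.replicate (bitsToNat (R src)) true))
      (26 * bitsToNat (R src) + 10 * (R src).length + 2) := by
  have h1 := runs_pour (a := src) (b := p) hsp R
  rw [hp, List.append_nil] at h1
  set R₁ := update (update R src []) p (R src).reverse with hR₁
  have h2 := runs_b2uLoop has hap haq har hsp hsq hsr hpq hpr hqr (R src).reverse 0 R₁
    (by simp [R₁]) (by simp [R₁, update_of_ne hap, update_of_ne has, hacc])
    (by simp [R₁, update_of_ne hpq.symm, update_of_ne hsq.symm, hq])
    (by simp [R₁, update_of_ne hpr.symm, update_of_ne hsr.symm, hr]) (by rw [hR₁, update_of_ne hsp, update_self])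
  rw [msbVal_reverse] at h2
  have hc := b2uCost_le 0 (R src).reverse
  rw [msbVal_reverse, List.length_reverse] at hc
  refine (h1.seq h2).of_eq ?_ (by omega)
  rw [hR₁, update_idem]
  funext i
  rcases eq_or_ne i acc with rfl | h1
  · rw [update_self, update_self]
  · rw [update_of_ne h1, update_of_ne h1]
    rcases eq_or_ne i p with rfl | h2
    · rw [update_self, update_of_ne hsp.symm, hp]
    · rw [update_of_ne h2]

end Com

end Literature.Computability.Complexity
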